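import Mathlib
import Summits.ValiantsHypothesis.ValiantsHypothesis.Theorems.LacunarySymmetroidMatrixDescartesGramDual

/-!
# `MatrixDescartes` (stmt-ValiantsHypothesis-18050) — the `J⁻¹`-ORTHOGONAL SPLITTING LAW: letter groups whose
# ranges are `J⁻¹`-orthogonal are ADDITIVE in the positive-zero count (all sizes, all exponents)

HONEST FRAMING.  Cell `pub-symmetroid`, seat `val-sym-mdr-p2` (gen 19); helper file `--supports` the crux
`Theses.LacunarySymmetroid.MatrixDescartes` (OPEN), NO closure claim; companion of `…GramDual` (the Gram duality
`X^{E R}·det(X^e J + V diag(X^δ) Vᵀ) = det J·X^{e m + Σδ}·det(diag(X^{E−δ}) + X^{E−e}·VᵀJ⁻¹V)`).  A structural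
ADDITIVITY LAW for the crux's class of pivot pencils with a non-degenerate pivot; nothing here bears on the crux in
its window, on `stub_twoSided`, on `DoorA26` / `DoorA34`, registers, or `VP ≠ VNP`.

**THEOREM (`card_posRoots_split_le`, the splitting law).**  `J` real with `det J ≠ 0` (no symmetry needed),
`V₁ : ι × ρ₁`, `V₂ : ι × ρ₂` real, exponents `δ₁, δ₂` arbitrary (both sides of the pivot allowed, ties allowed).
If the two letter groups are `J⁻¹`-ORTHOGONAL, `V₂ᵀ J⁻¹ V₁ = 0`, then

  `Z₊(X^e J + V₁ diag(X^{δ₁}) V₁ᵀ + V₂ diag(X^{δ₂}) V₂ᵀ) ≤ Z₊(X^e J + V₁ diag(X^{δ₁}) V₁ᵀ) + Z₊(X^e J + V₂ diag(X^{δ₂}) V₂ᵀ)`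

(`Z₊` = number of distinct positive zeros of the determinant).  REASON (`det_dual_split`): the Gram matrix of the
juxtaposed column system `fromCols V₁ V₂` is block-TRIANGULAR, so the dual word is block-triangular and its
determinant is the PRODUCT of the two groups' dual determinants (`Matrix.det_fromBlocks_zero₂₁`); the duality
transports this back to the primal words (`GramDual.posRoots_word_eq`).  The tree's block-sum additivity
(`stub_blockSector`) is the special case in which `J` is block-diagonal as well and the groups live in complementary
coordinate blocks; here `J` is ARBITRARY non-degenerate and the groups may overlap in every coordinate — e.g. at
`m = 2`, `J = diag(1, −1)`, columns `(2,1)` and `(1,2)` are `J`-orthogonal, and indeed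
`det(X^e J + X^a (2,1)(2,1)ᵀ + X^b (1,2)(1,2)ᵀ) = −(X^e + 3X^a)(X^e − 3X^b)` has exactly one positive zero for all
`a, b, e`.  Also: `word_fromCols_eq` (juxtaposed columns = sum of the two PSD parts), `gram_fromCols`
(Gram matrix of a juxtaposition = the `2 × 2` block matrix of cross-Grams), `dual_fromCols` (dual word of a
juxtaposition in block form), `card_posRoots_mul_le` (positive zeros of a product).

[folklore] (block-triangular determinants; the lacunary-pencil reading is this seat's.)  Axioms `propext`,
`Classical.choice`, `Quot.sound`.
-/

-- layout Summits/ValiantsHypothesis/ValiantsHypothesis forces the duplicated namespace component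
set_option linter.dupNamespace false

namespace Summit.ValiantsHypothesis.ValiantsHypothesis.Theorems.LacunarySymmetroidMatrixDescartes

open Polynomial Matrix Finset
open scoped BigOperators

namespace GramDual

variable {ι ρ ρ₁ ρ₂ : Type*} [Fintype ι] [DecidableEq ι] [Fintype ρ] [DecidableEq ρ]
  [Fintype ρ₁] [DecidableEq ρ₁] [Fintype ρ₂] [DecidableEq ρ₂]

/-- the primal word `X^e • J + V · diag(X^{δ j}) · Vᵀ` over `ℝ[X]` (file-local notation, as in `…GramDual`) -/
local notation3 (prettyPrint := false) "𝔽[" e ", " J ", " V ", " δ "]" =>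
  (((Polynomial.X : Polynomial ℝ) ^ (e : ℕ)) • (J : Matrix _ _ ℝ).map Polynomial.C
    + (V : Matrix _ _ ℝ).map Polynomial.C * Matrix.diagonal (fun j => (Polynomial.X : Polynomial ℝ) ^ (δ j : ℕ))
      * ((V : Matrix _ _ ℝ).map Polynomial.C)ᵀ)

/-- the PSD part alone, `V · diag(X^{δ j}) · Vᵀ` (file-local notation) -/
local notation3 (prettyPrint := false) "ℙ[" V ", " δ "]" =>
  ((V : Matrix _ _ ℝ).map Polynomial.C * Matrix.diagonal (fun j => (Polynomial.X : Polynomial ℝ) ^ (δ j : ℕ))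
      * ((V : Matrix _ _ ℝ).map Polynomial.C)ᵀ)

/-- the dual word `diag(X^{E − δ j}) + X^{E−e} • (VᵀJ⁻¹V)` over `ℝ[X]` (file-local notation, as in `…GramDual`) -/
local notation3 (prettyPrint := false) "𝔻[" E ", " e ", " J ", " V ", " δ "]" =>
  (Matrix.diagonal (fun j => (Polynomial.X : Polynomial ℝ) ^ ((E : ℕ) - δ j))
    + ((Polynomial.X : Polynomial ℝ) ^ ((E : ℕ) - (e : ℕ))) •
      ((V : Matrix _ _ ℝ)ᵀ * (J : Matrix _ _ ℝ)⁻¹ * (V : Matrix _ _ ℝ)).map Polynomial.C)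

/-! ## §1  Juxtaposed column systems -/

omit [Fintype ι] [DecidableEq ι] in
/-- **Juxtaposition = sum**: the PSD part of `fromCols V₁ V₂` with exponents `Sum.elim δ₁ δ₂` is the sum of the
two PSD parts. [folklore] -/
theorem psdPart_fromCols (V₁ : Matrix ι ρ₁ ℝ) (V₂ : Matrix ι ρ₂ ℝ) (δ₁ : ρ₁ → ℕ) (δ₂ : ρ₂ → ℕ) :
    ℙ[Matrix.fromCols V₁ V₂, Sum.elim δ₁ δ₂] = ℙ[V₁, δ₁] + ℙ[V₂, δ₂] := by
  have hdiag : Matrix.diagonal (fun j : ρ₁ ⊕ ρ₂ => (Polynomial.X : Polynomial ℝ) ^ (Sum.elim δ₁ δ₂ j))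
      = Matrix.fromBlocks (Matrix.diagonal fun j => (Polynomial.X : Polynomial ℝ) ^ δ₁ j) 0 0
          (Matrix.diagonal fun j => (Polynomial.X : Polynomial ℝ) ^ δ₂ j) := by
    rw [Matrix.fromBlocks_diagonal]
    congr 1
    funext j
    cases j <;> rfl
  rw [Matrix.fromCols_map, Matrix.transpose_fromCols, hdiag, Matrix.fromCols_mul_fromBlocks,
    Matrix.fromCols_mul_fromRows]
  simp only [Matrix.mul_zero, add_zero, zero_add]

omit [Fintype ι] [DecidableEq ι] in
/-- The primal word of a juxtaposition is the pivot plus the two PSD parts. [folklore] -/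
theorem word_fromCols_eq (e : ℕ) (J : Matrix ι ι ℝ) (V₁ : Matrix ι ρ₁ ℝ) (V₂ : Matrix ι ρ₂ ℝ) (δ₁ : ρ₁ → ℕ)
    (δ₂ : ρ₂ → ℕ) :
    𝔽[e, J, Matrix.fromCols V₁ V₂, Sum.elim δ₁ δ₂]
      = ((Polynomial.X : Polynomial ℝ) ^ e) • J.map Polynomial.C + ℙ[V₁, δ₁] + ℙ[V₂, δ₂] := by
  rw [psdPart_fromCols, add_assoc]

omit [Fintype ρ₁] [DecidableEq ρ₁] [Fintype ρ₂] [DecidableEq ρ₂] in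
/-- **Gram matrix of a juxtaposition** = the block matrix of the four cross-Gram matrices. [folklore] -/
theorem gram_fromCols (J : Matrix ι ι ℝ) (V₁ : Matrix ι ρ₁ ℝ) (V₂ : Matrix ι ρ₂ ℝ) :
    (Matrix.fromCols V₁ V₂)ᵀ * J⁻¹ * Matrix.fromCols V₁ V₂
      = Matrix.fromBlocks (V₁ᵀ * J⁻¹ * V₁) (V₁ᵀ * J⁻¹ * V₂) (V₂ᵀ * J⁻¹ * V₁) (V₂ᵀ * J⁻¹ * V₂) := by
  rw [Matrix.transpose_fromCols, Matrix.fromRows_mul, Matrix.fromRows_mul_fromCols]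

omit [Fintype ρ₁] [Fintype ρ₂] in
/-- **Dual word of a juxtaposition** in block form. [folklore] -/
theorem dual_fromCols (E e : ℕ) (J : Matrix ι ι ℝ) (V₁ : Matrix ι ρ₁ ℝ) (V₂ : Matrix ι ρ₂ ℝ) (δ₁ : ρ₁ → ℕ)
    (δ₂ : ρ₂ → ℕ) :
    𝔻[E, e, J, Matrix.fromCols V₁ V₂, Sum.elim δ₁ δ₂]
      = Matrix.fromBlocks (𝔻[E, e, J, V₁, δ₁])
          (((Polynomial.X : Polynomial ℝ) ^ (E - e)) • (V₁ᵀ * J⁻¹ * V₂).map Polynomial.C)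
          (((Polynomial.X : Polynomial ℝ) ^ (E - e)) • (V₂ᵀ * J⁻¹ * V₁).map Polynomial.C)
          (𝔻[E, e, J, V₂, δ₂]) := by
  have hdiag : Matrix.diagonal (fun j : ρ₁ ⊕ ρ₂ => (Polynomial.X : Polynomial ℝ) ^ (E - Sum.elim δ₁ δ₂ j))
      = Matrix.fromBlocks (Matrix.diagonal fun j => (Polynomial.X : Polynomial ℝ) ^ (E - δ₁ j)) 0 0
          (Matrix.diagonal fun j => (Polynomial.X : Polynomial ℝ) ^ (E - δ₂ j)) := by
    rw [Matrix.fromBlocks_diagonal]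
    congr 1
    funext j
    cases j <;> rfl
  rw [gram_fromCols, hdiag, Matrix.fromBlocks_map, Matrix.fromBlocks_smul, Matrix.fromBlocks_add]
  simp only [zero_add]

/-- **Block-triangular dual ⇒ product**: if `V₂ᵀJ⁻¹V₁ = 0` the dual determinant of the juxtaposition is the
product of the two dual determinants. [folklore] -/
theorem det_dual_split (E e : ℕ) (J : Matrix ι ι ℝ) (V₁ : Matrix ι ρ₁ ℝ) (V₂ : Matrix ι ρ₂ ℝ) (δ₁ : ρ₁ → ℕ)
    (δ₂ : ρ₂ → ℕ) (horth : V₂ᵀ * J⁻¹ * V₁ = 0) :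
    Matrix.det (𝔻[E, e, J, Matrix.fromCols V₁ V₂, Sum.elim δ₁ δ₂])
      = Matrix.det (𝔻[E, e, J, V₁, δ₁]) * Matrix.det (𝔻[E, e, J, V₂, δ₂]) := by
  rw [dual_fromCols, horth, Matrix.map_zero _ (map_zero _), smul_zero, Matrix.det_fromBlocks_zero₂₁]

/-! ## §2  Positive zeros of a product -/

/-- **Positive zeros of a product**: `Z₊(p·q) ≤ Z₊(p) + Z₊(q)` (when `p·q = 0` the left side is `0` by
convention). [folklore] -/
theorem card_posRoots_mul_le (p q : Polynomial ℝ) :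
    ((p * q).roots.toFinset.filter (fun t => 0 < t)).card
      ≤ (p.roots.toFinset.filter (fun t => 0 < t)).card + (q.roots.toFinset.filter (fun t => 0 < t)).card := by
  classical
  by_cases hpq : p * q = 0
  · rw [hpq, Polynomial.roots_zero, Multiset.toFinset_zero, Finset.filter_empty, Finset.card_empty]
    exact Nat.zero_le _
  rw [Polynomial.roots_mul hpq, Multiset.toFinset_add, Finset.filter_union]
  exact Finset.card_union_le _ _

/-! ## §3  The splitting law -/

/-- **THE `J⁻¹`-ORTHOGONAL SPLITTING LAW (juxtaposed form).**  `det J ≠ 0`, `V₂ᵀJ⁻¹V₁ = 0` ⇒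
`Z₊(X^eJ + (V₁|V₂)·diag·(V₁|V₂)ᵀ) ≤ Z₊(X^eJ + V₁ diag V₁ᵀ) + Z₊(X^eJ + V₂ diag V₂ᵀ)`. [folklore] -/
theorem card_posRoots_fromCols_le (J : Matrix ι ι ℝ) (hJ : IsUnit J.det) (V₁ : Matrix ι ρ₁ ℝ)
    (V₂ : Matrix ι ρ₂ ℝ) (e : ℕ) (δ₁ : ρ₁ → ℕ) (δ₂ : ρ₂ → ℕ) (horth : V₂ᵀ * J⁻¹ * V₁ = 0) :
    ((Matrix.det (𝔽[e, J, Matrix.fromCols V₁ V₂, Sum.elim δ₁ δ₂])).roots.toFinset.filter (fun t => 0 < t)).card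
      ≤ ((Matrix.det (𝔽[e, J, V₁, δ₁])).roots.toFinset.filter (fun t => 0 < t)).card
        + ((Matrix.det (𝔽[e, J, V₂, δ₂])).roots.toFinset.filter (fun t => 0 < t)).card := by
  classical
  -- a common exponent bound
  set E : ℕ := e + ∑ j, δ₁ j + ∑ j, δ₂ j with hE
  have he : e ≤ E := by omega
  have hδ₁ : ∀ j, δ₁ j ≤ E := fun j =>
    (Finset.single_le_sum (f := δ₁) (fun i _ => Nat.zero_le _) (Finset.mem_univ j)).trans (by omega)
  have hδ₂ : ∀ j, δ₂ j ≤ E := fun j =>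
    (Finset.single_le_sum (f := δ₂) (fun i _ => Nat.zero_le _) (Finset.mem_univ j)).trans (by omega)
  have hδ : ∀ j, Sum.elim δ₁ δ₂ j ≤ E := fun j => by
    cases j with
    | inl j => exact hδ₁ j
    | inr j => exact hδ₂ j
  rw [posRoots_word_eq J hJ _ e E _ he hδ, posRoots_word_eq J hJ V₁ e E δ₁ he hδ₁,
    posRoots_word_eq J hJ V₂ e E δ₂ he hδ₂, det_dual_split E e J V₁ V₂ δ₁ δ₂ horth]
  exact card_posRoots_mul_le _ _

/-- **THE `J⁻¹`-ORTHOGONAL SPLITTING LAW.**  For every real `J` with `det J ≠ 0`, all real `V₁ : ι × ρ₁`,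
`V₂ : ι × ρ₂`, all exponents `e, δ₁, δ₂`: if the two column systems are `J⁻¹`-orthogonal (`V₂ᵀJ⁻¹V₁ = 0`),
the word `X^e J + V₁ diag(X^{δ₁}) V₁ᵀ + V₂ diag(X^{δ₂}) V₂ᵀ` has at most as many distinct positive zeros of its
determinant as the two one-group words together.  Both groups may carry letters on both sides of the pivot;
no symmetry or sign hypothesis on `J`. [folklore] -/
theorem card_posRoots_split_le (J : Matrix ι ι ℝ) (hJ : IsUnit J.det) (V₁ : Matrix ι ρ₁ ℝ)
    (V₂ : Matrix ι ρ₂ ℝ) (e : ℕ) (δ₁ : ρ₁ → ℕ) (δ₂ : ρ₂ → ℕ) (horth : V₂ᵀ * J⁻¹ * V₁ = 0) :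
    ((Matrix.det (((Polynomial.X : Polynomial ℝ) ^ e) • J.map Polynomial.C + ℙ[V₁, δ₁] + ℙ[V₂, δ₂])
        ).roots.toFinset.filter (fun t => 0 < t)).card
      ≤ ((Matrix.det (𝔽[e, J, V₁, δ₁])).roots.toFinset.filter (fun t => 0 < t)).card
        + ((Matrix.det (𝔽[e, J, V₂, δ₂])).roots.toFinset.filter (fun t => 0 < t)).card := by
  rw [← word_fromCols_eq]
  exact card_posRoots_fromCols_le J hJ V₁ V₂ e δ₁ δ₂ horth

/-- **Symmetric-pivot form**: for symmetric `J` the orthogonality may be checked in either order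
(`V₁ᵀJ⁻¹V₂ = 0`). [folklore] -/
theorem card_posRoots_split_le' (J : Matrix ι ι ℝ) (hJs : J.IsSymm) (hJ : IsUnit J.det) (V₁ : Matrix ι ρ₁ ℝ)
    (V₂ : Matrix ι ρ₂ ℝ) (e : ℕ) (δ₁ : ρ₁ → ℕ) (δ₂ : ρ₂ → ℕ) (horth : V₁ᵀ * J⁻¹ * V₂ = 0) :
    ((Matrix.det (((Polynomial.X : Polynomial ℝ) ^ e) • J.map Polynomial.C + ℙ[V₁, δ₁] + ℙ[V₂, δ₂])
        ).roots.toFinset.filter (fun t => 0 < t)).card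
      ≤ ((Matrix.det (𝔽[e, J, V₁, δ₁])).roots.toFinset.filter (fun t => 0 < t)).card
        + ((Matrix.det (𝔽[e, J, V₂, δ₂])).roots.toFinset.filter (fun t => 0 < t)).card := by
  refine card_posRoots_split_le J hJ V₁ V₂ e δ₁ δ₂ ?_
  have h := congrArg Matrix.transpose horth
  rw [Matrix.transpose_zero, Matrix.transpose_mul, Matrix.transpose_mul, Matrix.transpose_transpose,
    Matrix.transpose_nonsing_inv, hJs.eq, ← Matrix.mul_assoc] at h
  exact h

end GramDual

end Summit.ValiantsHypothesis.ValiantsHypothesis.Theorems.LacunarySymmetroidMatrixDescartes
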